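import Literature.MathematicalPhysics.QuantumFieldTheory.OSSkeletonVClusters
import Literature.MathematicalPhysics.QuantumFieldTheory.OSSkeletonFunctional
import Literature.MathematicalPhysics.QuantumFieldTheory.OSFrames
import HarnessLib

/-!
# The skeleton Schwinger function of the directional variables (OS II, Ch. V, Method B)

Topic `Literature/MathematicalPhysics/QuantumFieldTheory`; the Method-B counterpart of
`OSSkeletonFunctional`. Osterwalder–Schrader II (Comm. Math. Phys. 42 (1975)), Ch. V.1,
(5.5)–(5.7): fix difference variables `ξ = (ξ₀, …, ξ_k)` in a cone around the time axis and
directions `ê_μ` close to the time axis; consider the configurations with differences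
`ξᵢ + ∑_μ u_{iμ} ê_μ`, `u ≥ 0`, i.e. points `pⱼ(u) = ∑_{i<j} (ξᵢ + ∑_μ u_{iμ} ê_μ)` (`posV`), and
the **directional skeleton Schwinger function**

  `𝒮(u) = 𝔖_{k+2}(⊗ⱼ φⱼ(· - pⱼ(u)))`   (`skelSV`)

of fixed one-point profiles `φⱼ` supported in the ball of radius `r`. For every slot `(i, μ)`,
passing by Euclidean covariance to the frame `L_μ = frameIso ê_μ` in which `ê_μ` is the time
axis (`OSFrames`, `OSSkeletonVClusters.schwinger_skeletonFnV_frame`), the variable `u_{iμ}` becomes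
a pure time shift of the points after the gap `i`, and the pairing identity gives the **slot
identity** (`skelSV_update_eq_genPairing`)

  `𝒮(u[(i,μ) ↦ s]) = genPairing (P_{iμ}(u)) (shiftGen s (R_{iμ}(u)))`,  `s ≥ 0`,

with positive-time generators `P_{iμ}(u) = leftGenV …`, `R_{iμ}(u) = rightGenV …` built in the
frame `μ` from `u` with its `(i, μ)` entry set to `0` — provided `⟪ê_μ, ξᵢ⟫ ≥ g > 2r` and
`⟪ê_μ, ê_ν⟫ ≥ 0` (cone conditions). Consequently the **holomorphic slot function**
`slotExtV = gapContinuation P R` (`⟪v(P), e^{-τH} v(R)⟫`) continues `s ↦ 𝒮(u[(i,μ) ↦ s])` to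
`{Re τ > 0}`, with polynomial bounds and continuity in `u` exactly as in `OSSkeletonFunctional`.
"By (5.4) and (5.6) the right hand side of (5.7) can be analytically continued to `ℂ₊` in each
of the variables `u_i^μ` separately" (p. 291).

## References

* K. Osterwalder, R. Schrader, *Axioms for Euclidean Green's functions II*, Comm. Math. Phys.
  42 (1975) 281–305, Ch. V.1 pp. 291–292, (5.4)–(5.7). [OsterwalderSchraderCMP1975]
-/

noncomputable section

open MeasureTheory Set Filter
open _root_.Topology
open scoped InnerProductSpace RealInnerProductSpace NNReal ComplexConjugate SchwartzMap

namespace Literature.MathematicalPhysics.QuantumFieldTheory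

variable {d : ℕ}

open Literature.MathematicalPhysics.QuantumLattice (SchwingerFamily IsPositiveTimeMulti)
open Literature.MathematicalPhysics.QuantumLattice.SchwingerFamily
open Literature.MathematicalPhysics.QuantumLattice.SchwingerFamily.OSSpace
open OSFrames

/-! ### Positions from directional variables -/

section Positions

variable {k : ℕ} (ξ : Fin (k + 1) → EuclideanSpace ℝ (Fin d)) (ê : Fin d → EuclideanSpace ℝ (Fin d))

/-- The **directional differences** `ξᵢ + ∑_μ u_{iμ} ê_μ`. [cite: OsterwalderSchraderCMP1975, Ch. V.1 eq. (5.7)] -/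
def dirDiff (u : Fin (k + 1) × Fin d → ℝ) (i : Fin (k + 1)) : EuclideanSpace ℝ (Fin d) :=
  ξ i + ∑ μ, u (i, μ) • ê μ

/-- The **positions** `pⱼ(u) = ∑_{i<j} (ξᵢ + ∑_μ u_{iμ} ê_μ)` (`p₀ = 0`). [cite: OsterwalderSchraderCMP1975, Ch. V.1 eq. (5.7)] -/
def posV (u : Fin (k + 1) × Fin d → ℝ) (j : Fin (k + 2)) : EuclideanSpace ℝ (Fin d) :=
  ∑ i ∈ Finset.univ.filter (fun i : Fin (k + 1) => i.val < j.val), dirDiff ξ ê u i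

/-- Continuity of the directional differences. [folklore] -/
theorem continuous_dirDiff : Continuous (dirDiff ξ ê) := by
  refine continuous_pi fun i => continuous_const.add (continuous_finsetSum _ fun μ _ => ?_)
  exact (continuous_apply _).smul continuous_const

/-- Continuity of the positions. [folklore] -/
theorem continuous_posV : Continuous (posV ξ ê) :=
  continuous_pi fun _ => continuous_finsetSum _ fun i _ => (continuous_apply i).comp (continuous_dirDiff ξ ê)

/-- Affine bound of the directional differences: `‖ξᵢ + ∑ u ê‖ ≤ ‖ξ‖ + (∑_μ ‖ê_μ‖) ‖u‖`. [folklore] -/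
theorem norm_dirDiff_le (u : Fin (k + 1) × Fin d → ℝ) (i : Fin (k + 1)) :
    ‖dirDiff ξ ê u i‖ ≤ ‖ξ‖ + (∑ μ, ‖ê μ‖) * ‖u‖ := by
  unfold dirDiff
  refine (norm_add_le _ _).trans (add_le_add (norm_le_pi_norm ξ i) ?_)
  refine (norm_sum_le _ _).trans ?_
  rw [Finset.sum_mul]
  refine Finset.sum_le_sum fun μ _ => ?_
  rw [norm_smul, mul_comm]
  exact mul_le_mul_of_nonneg_left (norm_le_pi_norm u (i, μ)) (norm_nonneg _)

/-- Affine bound of the positions: `‖pⱼ(u)‖ ≤ (k+1)(‖ξ‖ + (∑‖ê_μ‖) ‖u‖)`. [folklore] -/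
theorem norm_posV_le (u : Fin (k + 1) × Fin d → ℝ) :
    ‖posV ξ ê u‖ ≤ (k + 1) * (‖ξ‖ + (∑ μ, ‖ê μ‖) * ‖u‖) := by
  refine (pi_norm_le_iff_of_nonneg (by positivity)).2 fun j => ?_
  unfold posV
  refine (norm_sum_le _ _).trans ?_
  calc ∑ i ∈ Finset.univ.filter (fun i : Fin (k + 1) => i.val < j.val), ‖dirDiff ξ ê u i‖
      ≤ ∑ _i : Fin (k + 1), (‖ξ‖ + (∑ μ, ‖ê μ‖) * ‖u‖) :=
        (Finset.sum_le_sum_of_subset_of_nonneg (Finset.filter_subset _ _) fun i _ _ => norm_nonneg _).trans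
          (Finset.sum_le_sum fun i _ => norm_dirDiff_le ξ ê u i)
    _ = (k + 1) * (‖ξ‖ + (∑ μ, ‖ê μ‖) * ‖u‖) := by simp; ring

/-- A directional difference with its `(i, μ)` entry updated. [folklore] -/
theorem dirDiff_update_same (u : Fin (k + 1) × Fin d → ℝ) (i : Fin (k + 1)) (μ : Fin d) (s : ℝ) :
    dirDiff ξ ê (Function.update u (i, μ) s) i = dirDiff ξ ê u i + (s - u (i, μ)) • ê μ := by
  unfold dirDiff
  rw [add_assoc, ← Finset.sum_erase_add _ _ (Finset.mem_univ μ), ← Finset.sum_erase_add _ _ (Finset.mem_univ μ),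
    Function.update_self]
  have h : ∑ ν ∈ Finset.univ.erase μ, Function.update u (i, μ) s (i, ν) • ê ν =
      ∑ ν ∈ Finset.univ.erase μ, u (i, ν) • ê ν :=
    Finset.sum_congr rfl fun ν hν => by
      rw [Function.update_of_ne (fun h => Finset.ne_of_mem_erase hν (Prod.ext_iff.1 h).2)]
  rw [h, sub_smul]
  abel

/-- The other directional differences are unchanged. [folklore] -/
theorem dirDiff_update_of_ne (u : Fin (k + 1) × Fin d → ℝ) {i i' : Fin (k + 1)} (h : i' ≠ i) (μ : Fin d)
    (s : ℝ) : dirDiff ξ ê (Function.update u (i, μ) s) i' = dirDiff ξ ê u i' := by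
  unfold dirDiff
  congr 1
  exact Finset.sum_congr rfl fun ν _ => by
    rw [Function.update_of_ne (fun h' => h (Prod.ext_iff.1 h').1)]

/-- **Positions before the gap `i` do not see `u_{iμ}`.** [folklore] -/
theorem posV_update_of_le (u : Fin (k + 1) × Fin d → ℝ) (i : Fin (k + 1)) (μ : Fin d) (s : ℝ)
    {j : Fin (k + 2)} (hj : j.val ≤ i.val) :
    posV ξ ê (Function.update u (i, μ) s) j = posV ξ ê u j := by
  unfold posV
  refine Finset.sum_congr rfl fun i' hi' => ?_
  rw [Finset.mem_filter] at hi'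
  exact dirDiff_update_of_ne ξ ê u (fun h => by rw [h] at hi'; omega) μ s

/-- **Positions after the gap `i` are shifted by `(s - u_{iμ}) ê_μ`.** [folklore] -/
theorem posV_update_of_lt (u : Fin (k + 1) × Fin d → ℝ) (i : Fin (k + 1)) (μ : Fin d) (s : ℝ)
    {j : Fin (k + 2)} (hj : i.val < j.val) :
    posV ξ ê (Function.update u (i, μ) s) j = posV ξ ê u j + (s - u (i, μ)) • ê μ := by
  unfold posV
  have hi : i ∈ Finset.univ.filter (fun i' : Fin (k + 1) => i'.val < j.val) :=
    Finset.mem_filter.2 ⟨Finset.mem_univ _, hj⟩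
  rw [← Finset.add_sum_erase _ _ hi, ← Finset.add_sum_erase _ _ hi, dirDiff_update_same]
  have hrest : ∑ x ∈ (Finset.univ.filter (fun i' : Fin (k + 1) => i'.val < j.val)).erase i,
      dirDiff ξ ê (Function.update u (i, μ) s) x =
      ∑ x ∈ (Finset.univ.filter (fun i' : Fin (k + 1) => i'.val < j.val)).erase i, dirDiff ξ ê u x :=
    Finset.sum_congr rfl fun x hx => dirDiff_update_of_ne ξ ê u (Finset.ne_of_mem_erase hx) μ s
  rw [hrest]
  abel

/-- Differences of positions across the gap `i`: for `j ≤ i < j'`,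
`p_{j'}(u) - p_j(u) = ∑_{j ≤ i' < j'} dirDiff u i'` contains the term `i`; in a frame `ê` with
`⟪ê, dirDiff u i'⟫ ≥ 0` for all `i'` and `⟪ê, dirDiff u i⟫ ≥ g`, `⟪ê, p_{j'}(u) - p_j(u)⟫ ≥ g`. [folklore] -/
theorem inner_posV_sub_ge (u : Fin (k + 1) × Fin d → ℝ) {e : EuclideanSpace ℝ (Fin d)} {g : ℝ}
    (h0 : ∀ i', 0 ≤ ⟪e, dirDiff ξ ê u i'⟫) (i : Fin (k + 1)) (hg : g ≤ ⟪e, dirDiff ξ ê u i⟫)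
    {j j' : Fin (k + 2)} (hj : j.val ≤ i.val) (hj' : i.val < j'.val) :
    g ≤ ⟪e, posV ξ ê u j' - posV ξ ê u j⟫ := by
  unfold posV
  have hsub : Finset.univ.filter (fun i' : Fin (k + 1) => i'.val < j.val) ⊆
      Finset.univ.filter (fun i' : Fin (k + 1) => i'.val < j'.val) := by
    intro i' hi'
    rw [Finset.mem_filter] at hi' ⊢
    exact ⟨hi'.1, by omega⟩
  rw [← Finset.sum_sdiff hsub, add_sub_cancel_right, inner_sum]
  have hi : i ∈ Finset.univ.filter (fun i' : Fin (k + 1) => i'.val < j'.val) \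
      Finset.univ.filter (fun i' : Fin (k + 1) => i'.val < j.val) := by
    simp only [Finset.mem_sdiff, Finset.mem_filter, Finset.mem_univ, true_and, not_lt]
    exact ⟨hj', hj⟩
  rw [← Finset.add_sum_erase _ _ hi]
  have hrest : 0 ≤ ∑ x ∈ (Finset.univ.filter (fun i' : Fin (k + 1) => i'.val < j'.val) \
      Finset.univ.filter (fun i' : Fin (k + 1) => i'.val < j.val)).erase i, ⟪e, dirDiff ξ ê u x⟫ :=
    Finset.sum_nonneg fun i' _ => h0 i'
  linarith

/-- Monotonicity of the positions in a frame: for `j ≤ j'` and `⟪e, dirDiff u i'⟫ ≥ 0`,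
`⟪e, p_j(u)⟫ ≤ ⟪e, p_{j'}(u)⟫`. [folklore] -/
theorem inner_posV_mono (u : Fin (k + 1) × Fin d → ℝ) {e : EuclideanSpace ℝ (Fin d)}
    (h0 : ∀ i', 0 ≤ ⟪e, dirDiff ξ ê u i'⟫) {j j' : Fin (k + 2)} (hjj' : j.val ≤ j'.val) :
    ⟪e, posV ξ ê u j⟫ ≤ ⟪e, posV ξ ê u j'⟫ := by
  unfold posV
  rw [inner_sum, inner_sum]
  refine Finset.sum_le_sum_of_subset_of_nonneg (fun i' hi' => ?_) fun i' _ _ => h0 i'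
  rw [Finset.mem_filter] at hi' ⊢
  exact ⟨hi'.1, by omega⟩

/-- In a frame `e` with `⟪e, ξᵢ⟫ ≥ g ≥ 0`, `⟪e, ê_ν⟫ ≥ 0` and `u ≥ 0`, every directional
difference satisfies `⟪e, dirDiff u i⟫ ≥ g`. [folklore] -/
theorem le_inner_dirDiff {u : Fin (k + 1) × Fin d → ℝ} (hu : ∀ p, 0 ≤ u p) {e : EuclideanSpace ℝ (Fin d)}
    {g : ℝ} (hξ : ∀ i, g ≤ ⟪e, ξ i⟫) (hê : ∀ ν, 0 ≤ ⟪e, ê ν⟫) (i : Fin (k + 1)) :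
    g ≤ ⟪e, dirDiff ξ ê u i⟫ := by
  unfold dirDiff
  rw [inner_add_right, inner_sum]
  have h : 0 ≤ ∑ ν, ⟪e, u (i, ν) • ê ν⟫ :=
    Finset.sum_nonneg fun ν _ => by rw [inner_smul_right]; exact mul_nonneg (hu _) (hê ν)
  linarith [hξ i]

end Positions

/-! ### The directional skeleton Schwinger function -/

section Skeleton

variable (𝔖 : SchwingerFamily (EuclideanSpace ℝ (Fin d))) {k : ℕ}
  (φ : Fin (k + 2) → 𝓢(EuclideanSpace ℝ (Fin d), ℂ)) (ξ : Fin (k + 1) → EuclideanSpace ℝ (Fin d))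
  (ê : Fin d → EuclideanSpace ℝ (Fin d))

/-- The **directional skeleton Schwinger function** `𝒮(u) = 𝔖_{k+2}(⊗ⱼ φⱼ(· - pⱼ(u)))`. [cite: OsterwalderSchraderCMP1975, Ch. V.1 eq. (5.7)] -/
def skelSV (u : Fin (k + 1) × Fin d → ℝ) : ℂ :=
  𝔖 (k + 2) (skeletonFnV (SchwartzMap.tensorFin (k + 2) φ) (posV ξ ê u))

/-- Continuity of `𝒮`. [folklore] -/
theorem continuous_skelSV : Continuous (skelSV 𝔖 φ ξ ê) :=
  (𝔖 (k + 2)).continuous.comp ((continuous_skeletonFnV _).comp (continuous_posV ξ ê))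

/-- **Polynomial bound for Schwinger functions of clusters at vector positions**:
`|𝔖_K(skeletonFnV Φ₀ p)| ≤ C (1 + ‖p‖)ᴺ` (temperedness of `𝔖_K` and `seminorm_skeletonFnV_le`). [folklore] -/
theorem exists_norm_schwinger_skeletonFnV_le {K : ℕ} (Φ₀ : 𝓢((Fin K → EuclideanSpace ℝ (Fin d)), ℂ)) :
    ∃ (C : ℝ) (N : ℕ), 0 ≤ C ∧ ∀ p : Fin K → EuclideanSpace ℝ (Fin d),
      ‖𝔖 K (skeletonFnV Φ₀ p)‖ ≤ C * (1 + ‖p‖) ^ N := by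
  obtain ⟨s, C₀, hS⟩ := exists_bound_holds 𝔖 K
  set M : ℝ := (Finset.Iic (s, s)).sup' ⟨(s, s), Finset.mem_Iic.2 le_rfl⟩ fun q =>
    SchwartzMap.seminorm ℂ q.1 q.2 Φ₀ + SchwartzMap.seminorm ℂ 0 q.2 Φ₀ with hM
  have hM0 : 0 ≤ M := by
    rw [hM]
    exact le_trans (by positivity) (Finset.le_sup' (fun q : ℕ × ℕ =>
      SchwartzMap.seminorm ℂ q.1 q.2 Φ₀ + SchwartzMap.seminorm ℂ 0 q.2 Φ₀) (Finset.mem_Iic.2 le_rfl))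
  have hnorm : ∀ p : Fin K → EuclideanSpace ℝ (Fin d),
      QuantumLattice.schwartzNorm s (skeletonFnV Φ₀ p) ≤ 2 ^ s * (1 + ‖p‖) ^ s * M := by
    intro p
    unfold QuantumLattice.schwartzNorm
    refine Seminorm.finset_sup_apply_le (by positivity) fun q hq => ?_
    rw [Finset.mem_Iic] at hq
    rw [SchwartzMap.schwartzSeminormFamily_apply]
    refine (seminorm_skeletonFnV_le Φ₀ q.1 q.2 p).trans ?_
    have h1 : (2 : ℝ) ^ q.1 ≤ 2 ^ s := pow_le_pow_right₀ (by norm_num) hq.1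
    have h2 : (1 + ‖p‖) ^ q.1 ≤ (1 + ‖p‖) ^ s :=
      pow_le_pow_right₀ (by linarith [norm_nonneg p]) hq.1
    have h3 : SchwartzMap.seminorm ℂ q.1 q.2 Φ₀ + SchwartzMap.seminorm ℂ 0 q.2 Φ₀ ≤ M :=
      Finset.le_sup' (fun q : ℕ × ℕ => SchwartzMap.seminorm ℂ q.1 q.2 Φ₀ + SchwartzMap.seminorm ℂ 0 q.2 Φ₀)
        (Finset.mem_Iic.2 hq)
    have h4 : 0 ≤ SchwartzMap.seminorm ℂ q.1 q.2 Φ₀ + SchwartzMap.seminorm ℂ 0 q.2 Φ₀ := by positivity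
    gcongr
  refine ⟨|C₀| * (2 ^ s * M), s, by positivity, fun p => ?_⟩
  refine (hS _).trans ?_
  have hC : C₀ * QuantumLattice.schwartzNorm s (skeletonFnV Φ₀ p) ≤
      |C₀| * QuantumLattice.schwartzNorm s (skeletonFnV Φ₀ p) :=
    mul_le_mul_of_nonneg_right (le_abs_self _) (QuantumLattice.schwartzNorm_nonneg _ _)
  refine hC.trans ?_
  calc |C₀| * QuantumLattice.schwartzNorm s (skeletonFnV Φ₀ p) ≤ |C₀| * (2 ^ s * (1 + ‖p‖) ^ s * M) :=
        mul_le_mul_of_nonneg_left (hnorm p) (abs_nonneg _)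
    _ = |C₀| * (2 ^ s * M) * (1 + ‖p‖) ^ s := by ring

/-- **Polynomial bound of the directional skeleton Schwinger function**: `|𝒮(u)| ≤ C (1 + ‖u‖)ᴺ`. [folklore] -/
theorem exists_norm_skelSV_le :
    ∃ (C : ℝ) (N : ℕ), 0 ≤ C ∧ ∀ u, ‖skelSV 𝔖 φ ξ ê u‖ ≤ C * (1 + ‖u‖) ^ N := by
  obtain ⟨C, N, hC, hb⟩ := exists_norm_schwinger_skeletonFnV_le 𝔖 (SchwartzMap.tensorFin (k + 2) φ)
  set D : ℝ := 1 + (k + 1) * (‖ξ‖ + ∑ μ, ‖ê μ‖) with hD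
  have hD0 : 0 ≤ D := by positivity
  refine ⟨C * D ^ N, N, by positivity, fun u => (hb _).trans ?_⟩
  have h1 : 1 + ‖posV ξ ê u‖ ≤ D * (1 + ‖u‖) := by
    have h := norm_posV_le ξ ê u
    rw [hD]
    have hE : 0 ≤ ∑ μ, ‖ê μ‖ := Finset.sum_nonneg fun μ _ => norm_nonneg _
    nlinarith [norm_nonneg u, norm_nonneg ξ, mul_nonneg hE (norm_nonneg u),
      mul_nonneg (by positivity : (0 : ℝ) ≤ k + 1) (norm_nonneg ξ),
      mul_nonneg (by positivity : (0 : ℝ) ≤ k + 1) (mul_nonneg hE (norm_nonneg u))]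
  calc C * (1 + ‖posV ξ ê u‖) ^ N ≤ C * (D * (1 + ‖u‖)) ^ N := by gcongr
    _ = C * D ^ N * (1 + ‖u‖) ^ N := by rw [mul_pow]; ring

end Skeleton

/-! ### The slot `(i, μ)`: frame, anchor, generators -/

section Slot

variable {k : ℕ} (i : Fin (k + 1)) (μ : Fin d)

/-- The parameters with the slot entry `(i, μ)` set to `0`. [folklore] -/
def zeroSlot (u : Fin (k + 1) × Fin d → ℝ) : Fin (k + 1) × Fin d → ℝ := Function.update u (i, μ) 0

variable {i μ}

/-- `zeroSlot` is nonnegative if `u` is. [folklore] -/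
theorem zeroSlot_nonneg {u : Fin (k + 1) × Fin d → ℝ} (hu : ∀ p, 0 ≤ u p) (p : Fin (k + 1) × Fin d) :
    0 ≤ zeroSlot i μ u p := by
  unfold zeroSlot
  by_cases hp : p = (i, μ)
  · subst hp; simp
  · rw [Function.update_of_ne hp]; exact hu p

/-- Updating the slot entry of `u` is updating it in `zeroSlot u`. [folklore] -/
theorem update_eq_update_zeroSlot (u : Fin (k + 1) × Fin d → ℝ) (s : ℝ) :
    Function.update u (i, μ) s = Function.update (zeroSlot i μ u) (i, μ) s := by
  unfold zeroSlot; simp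

/-- The slot entry of `zeroSlot u` vanishes. [folklore] -/
@[simp] theorem zeroSlot_apply_same (u : Fin (k + 1) × Fin d → ℝ) : zeroSlot i μ u (i, μ) = 0 := by
  simp [zeroSlot]

variable [NeZero d] (φ : Fin (k + 2) → 𝓢(EuclideanSpace ℝ (Fin d), ℂ))
  (ξ : Fin (k + 1) → EuclideanSpace ℝ (Fin d)) (ê : Fin d → EuclideanSpace ℝ (Fin d)) (i μ) (g : ℝ)

/-- The profiles in the frame `μ`: `φⱼ ∘ L_μ⁻¹`, relabelled along `nL i + nR i = k + 2`. [folklore] -/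
def φrot (j : Fin (nL i + nR i)) : 𝓢(EuclideanSpace ℝ (Fin d), ℂ) :=
  rotOne (frameIso (ê μ)) (φ (Fin.cast (nL_add_nR i) j))

/-- The **anchored frame positions**: `qⱼ(u) = L_μ pⱼ(u₀) - L_μ p_i(u₀) - (g/2) e₀`, `u₀ = zeroSlot u`
(the last point before the gap sits at time `-g/2`). [folklore] -/
def framePos (u : Fin (k + 1) × Fin d → ℝ) (j : Fin (k + 2)) : EuclideanSpace ℝ (Fin d) :=
  frameIso (ê μ) (posV ξ ê (zeroSlot i μ u) j) - frameIso (ê μ) (posV ξ ê (zeroSlot i μ u) i.castSucc) -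
    timeVec (g / 2)

/-- The **left generator of the slot `(i, μ)`**. [folklore] -/
def leftGenV (u : Fin (k + 1) × Fin d → ℝ) : 𝓢((Fin (nL i) → EuclideanSpace ℝ (Fin d)), ℂ) :=
  leftGenFnV (φrot i μ φ ê) fun j => framePos i μ ξ ê g u (Fin.cast (nL_add_nR i) j)

/-- The **right generator of the slot `(i, μ)`**. [folklore] -/
def rightGenV (u : Fin (k + 1) × Fin d → ℝ) : 𝓢((Fin (nR i) → EuclideanSpace ℝ (Fin d)), ℂ) :=
  rightGenFnV (φrot i μ φ ê) (fun j => framePos i μ ξ ê g u (Fin.cast (nL_add_nR i) j)) 0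

variable {φ ξ ê i μ g}

/-- `timeVec s = s • e₀`. [folklore] -/
theorem timeVec_eq_smul_timeAxis (s : ℝ) : (timeVec s : EuclideanSpace ℝ (Fin d)) = s • timeAxis := by
  ext j
  simp [timeVec, timeAxis, PiLp.single_apply]

/-- **The time coordinates of the anchored frame positions**:
`(qⱼ(u))⁰ = ⟪ê_μ, pⱼ(u₀)⟫ - ⟪ê_μ, p_i(u₀)⟫ - g/2`. [folklore] -/
theorem framePos_apply_zero (hê1 : ‖ê μ‖ = 1) (u : Fin (k + 1) × Fin d → ℝ) (j : Fin (k + 2)) :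
    framePos i μ ξ ê g u j 0 =
      ⟪ê μ, posV ξ ê (zeroSlot i μ u) j⟫ - ⟪ê μ, posV ξ ê (zeroSlot i μ u) i.castSucc⟫ - g / 2 := by
  unfold framePos
  simp only [PiLp.sub_apply, frameIso_apply_zero hê1, timeVec]
  simp

variable {r : ℝ}

/-- The rotated profiles have time supports in `{|y⁰| ≤ r}`. [folklore] -/
theorem tsupport_φrot (hφ : ∀ j, tsupport (φ j : EuclideanSpace ℝ (Fin d) → ℂ) ⊆ Metric.closedBall 0 r)
    (j : Fin (nL i + nR i)) :
    tsupport (φrot i μ φ ê j : EuclideanSpace ℝ (Fin d) → ℂ) ⊆ {y | |y 0| ≤ r} :=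
  slab_of_ball (tsupport_rotOne_subset (hφ _))

/-- **Left frame positions have times `< -r`** (for `u ≥ 0`, `⟪ê_μ, ξ_{i'}⟫ ≥ g > 2r ≥ 0`,
`⟪ê_μ, ê_ν⟫ ≥ 0`). [folklore] -/
theorem framePos_left_lt (hê1 : ‖ê μ‖ = 1) (hêê : ∀ ν, 0 ≤ ⟪ê μ, ê ν⟫) (hξ : ∀ i', g ≤ ⟪ê μ, ξ i'⟫)
    (hg : 2 * r < g) (hr : 0 ≤ r) {u : Fin (k + 1) × Fin d → ℝ} (hu : ∀ p, 0 ≤ u p) (j : Fin (nL i)) :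
    framePos i μ ξ ê g u (Fin.cast (nL_add_nR i) (Fin.castAdd (nR i) j)) 0 < -r := by
  rw [framePos_apply_zero hê1]
  have h0 : ∀ i', 0 ≤ ⟪ê μ, dirDiff ξ ê (zeroSlot i μ u) i'⟫ := fun i' =>
    le_trans (by linarith) (le_inner_dirDiff ξ ê (zeroSlot_nonneg hu) hξ hêê i')
  have hmono := inner_posV_mono ξ ê (zeroSlot i μ u) h0
    (j := Fin.cast (nL_add_nR i) (Fin.castAdd (nR i) j)) (j' := i.castSucc) (by
      have := val_cast_castAdd_le (i := i) j; simpa using this)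
  linarith

/-- **Right frame positions have times `> r`** (same hypotheses). [folklore] -/
theorem framePos_right_gt (hê1 : ‖ê μ‖ = 1) (hêê : ∀ ν, 0 ≤ ⟪ê μ, ê ν⟫) (hξ : ∀ i', g ≤ ⟪ê μ, ξ i'⟫)
    (hg : 2 * r < g) (hr : 0 ≤ r) {u : Fin (k + 1) × Fin d → ℝ} (hu : ∀ p, 0 ≤ u p) (j : Fin (nR i)) :
    r + 0 < framePos i μ ξ ê g u (Fin.cast (nL_add_nR i) (Fin.natAdd (nL i) j)) 0 := by
  rw [framePos_apply_zero hê1, ← inner_sub_right]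
  have h0 : ∀ i', 0 ≤ ⟪ê μ, dirDiff ξ ê (zeroSlot i μ u) i'⟫ := fun i' =>
    le_trans (by linarith) (le_inner_dirDiff ξ ê (zeroSlot_nonneg hu) hξ hêê i')
  have hge := inner_posV_sub_ge ξ ê (zeroSlot i μ u) h0 i
    (le_inner_dirDiff ξ ê (zeroSlot_nonneg hu) hξ hêê i)
    (j := i.castSucc) (j' := Fin.cast (nL_add_nR i) (Fin.natAdd (nL i) j)) (by simp)
    (by have := lt_val_cast_natAdd (i := i) j; simpa using this)
  linarith

/-- **The left generator of the slot is positive-time.** [folklore] -/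
theorem isPositiveTimeMulti_leftGenV (hφ : ∀ j, tsupport (φ j : EuclideanSpace ℝ (Fin d) → ℂ) ⊆ Metric.closedBall 0 r)
    (hê1 : ‖ê μ‖ = 1) (hêê : ∀ ν, 0 ≤ ⟪ê μ, ê ν⟫) (hξ : ∀ i', g ≤ ⟪ê μ, ξ i'⟫)
    (hg : 2 * r < g) (hr : 0 ≤ r) {u : Fin (k + 1) × Fin d → ℝ} (hu : ∀ p, 0 ≤ u p) :
    IsPositiveTimeMulti (leftGenV i μ φ ξ ê g u) :=
  isPositiveTimeMulti_leftGenFnV (tsupport_φrot hφ) (framePos_left_lt hê1 hêê hξ hg hr hu)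

/-- **The right generator of the slot is positive-time.** [folklore] -/
theorem isPositiveTimeMulti_rightGenV (hφ : ∀ j, tsupport (φ j : EuclideanSpace ℝ (Fin d) → ℂ) ⊆ Metric.closedBall 0 r)
    (hê1 : ‖ê μ‖ = 1) (hêê : ∀ ν, 0 ≤ ⟪ê μ, ê ν⟫) (hξ : ∀ i', g ≤ ⟪ê μ, ξ i'⟫)
    (hg : 2 * r < g) (hr : 0 ≤ r) {u : Fin (k + 1) × Fin d → ℝ} (hu : ∀ p, 0 ≤ u p) :
    IsPositiveTimeMulti (rightGenV i μ φ ξ ê g u) :=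
  isPositiveTimeMulti_rightGenFnV (tsupport_φrot hφ) (framePos_right_gt hê1 hêê hξ hg hr hu)

/-! ### The slot identity -/

omit [NeZero d] in
/-- **Translation invariance for clusters at vector positions**: `𝔖 (Φ₀ at p) = 𝔖 (Φ₀ at p + c)`. [folklore] -/
theorem schwinger_skeletonFnV_add_const {𝔖 : SchwingerFamily (EuclideanSpace ℝ (Fin d))}
    (hE1 : 𝔖.IsEuclideanCovariant) {K : ℕ} (Φ₀ : 𝓢((Fin K → EuclideanSpace ℝ (Fin d)), ℂ))
    (p : Fin K → EuclideanSpace ℝ (Fin d)) (c : EuclideanSpace ℝ (Fin d)) :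
    𝔖 K (skeletonFnV Φ₀ p) = 𝔖 K (skeletonFnV Φ₀ fun j => p j + c) := by
  rw [← translateMulti_skeletonFnV, hE1.1 K c]

omit [NeZero d] in
/-- **Positions with the slot entry updated**: `pⱼ(u[(i,μ) ↦ s]) = pⱼ(u₀) + [i < j] s ê_μ`. [folklore] -/
theorem posV_update_eq (u : Fin (k + 1) × Fin d → ℝ) (s : ℝ) (j : Fin (k + 2)) :
    posV ξ ê (Function.update u (i, μ) s) j =
      posV ξ ê (zeroSlot i μ u) j + (if i.val < j.val then s • ê μ else 0) := by
  rw [update_eq_update_zeroSlot]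
  split_ifs with h
  · rw [posV_update_of_lt ξ ê _ i μ s h, zeroSlot_apply_same, sub_zero]
  · rw [posV_update_of_le ξ ê _ i μ s (not_lt.1 h), add_zero]

/-- The frame positions of the updated configuration, anchored: left points at `framePos`,
right points at `framePos + s e₀`. [folklore] -/
theorem frame_posV_update_eq (hê1 : ‖ê μ‖ = 1) (u : Fin (k + 1) × Fin d → ℝ) (s : ℝ) (j : Fin (k + 2)) :
    frameIso (ê μ) (posV ξ ê (Function.update u (i, μ) s) j) +
        (-(frameIso (ê μ) (posV ξ ê (zeroSlot i μ u) i.castSucc) + timeVec (g / 2))) =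
      framePos i μ ξ ê g u j + (if i.val < j.val then timeVec s else 0) := by
  rw [posV_update_eq, map_add, framePos]
  split_ifs with h
  · rw [map_smul, frameIso_apply_self hê1, ← timeVec_eq_smul_timeAxis]
    abel
  · rw [map_zero]
    abel

/-- **The slot identity for the slot `(i, μ)`** (OS II (5.7) with (5.4)): for `u ≥ 0` and `s ≥ 0`,
`𝒮(u[(i,μ) ↦ s]) = genPairing (P_{iμ}(u)) (shiftGen s (R_{iμ}(u)))`. Proof: Euclidean covariance to
the frame `L_μ` (`schwinger_skeletonFnV_frame`), translation to the anchor, the update moves the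
points after the gap by `s e₀` (`frame_posV_update_eq`), and the pairing identity
`schwinger_skeletonFnV_eq_genPairing`. [cite: OsterwalderSchraderCMP1975, Ch. V.1 eqs. (5.4), (5.7)] -/
theorem skelSV_update_eq_genPairing {𝔖 : SchwingerFamily (EuclideanSpace ℝ (Fin d))}
    (hE1 : 𝔖.IsEuclideanCovariant)
    (hφ : ∀ j, tsupport (φ j : EuclideanSpace ℝ (Fin d) → ℂ) ⊆ Metric.closedBall 0 r)
    (hê1 : ‖ê μ‖ = 1) (hêê : ∀ ν, 0 ≤ ⟪ê μ, ê ν⟫) (hξ : ∀ i', g ≤ ⟪ê μ, ξ i'⟫)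
    (hg : 2 * r < g) (hr : 0 ≤ r) {u : Fin (k + 1) × Fin d → ℝ} (hu : ∀ p, 0 ≤ u p) {s : ℝ} (hs : 0 ≤ s) :
    skelSV 𝔖 φ ξ ê (Function.update u (i, μ) s) =
      genPairing 𝔖 (mkGen (leftGenV i μ φ ξ ê g u) (isPositiveTimeMulti_leftGenV hφ hê1 hêê hξ hg hr hu))
        (shiftGen s (mkGen (rightGenV i μ φ ξ ê g u) (isPositiveTimeMulti_rightGenV hφ hê1 hêê hξ hg hr hu))) := by
  -- frame and anchor
  rw [skelSV, schwinger_skeletonFnV_frame hE1 (frameIso (ê μ)),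
    schwinger_skeletonFnV_add_const hE1 _ _
      (-(frameIso (ê μ) (posV ξ ê (zeroSlot i μ u) i.castSucc) + timeVec (g / 2)))]
  simp_rw [frame_posV_update_eq hê1]
  -- relabel along `nL i + nR i = k + 2` and apply the pairing identity with `t = s`
  rw [schwinger_skeletonFnV_tensorFin_cast 𝔖 (nL_add_nR i)]
  have hpL : ∀ j : Fin (nL i), (framePos i μ ξ ê g u (Fin.cast (nL_add_nR i) (Fin.castAdd (nR i) j)) +
      (if i.val < (Fin.cast (nL_add_nR i) (Fin.castAdd (nR i) j)).val then timeVec s else 0) :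
        EuclideanSpace ℝ (Fin d)) 0 < -r := by
    intro j
    rw [if_neg (not_lt.2 (val_cast_castAdd_le (i := i) j)), add_zero]
    exact framePos_left_lt hê1 hêê hξ hg hr hu j
  have hpR : ∀ j : Fin (nR i), r + s < (framePos i μ ξ ê g u (Fin.cast (nL_add_nR i) (Fin.natAdd (nL i) j)) +
      (if i.val < (Fin.cast (nL_add_nR i) (Fin.natAdd (nL i) j)).val then timeVec s else 0) :
        EuclideanSpace ℝ (Fin d)) 0 := by
    intro j
    rw [if_pos (lt_val_cast_natAdd (i := i) j), PiLp.add_apply]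
    have h := framePos_right_gt hê1 hêê hξ hg hr hu j
    have h0 : (timeVec s : EuclideanSpace ℝ (Fin d)) 0 = s := by simp [timeVec]
    rw [h0]
    linarith
  have key := schwinger_skeletonFnV_eq_genPairing 𝔖 (φ := φrot i μ φ ê)
    (p := fun j => framePos i μ ξ ê g u (Fin.cast (nL_add_nR i) j) +
      (if i.val < (Fin.cast (nL_add_nR i) j).val then timeVec s else 0))
    (tsupport_φrot hφ) hs hpL hpR
  refine Eq.trans rfl (key.trans ?_)
  refine genPairing_mkGen_congr 𝔖 ?_ _ _ ?_ _ _ s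
  · -- left generator: positions before the gap are the anchored frame positions
    unfold leftGenV leftGenFnV
    congr 2
    funext j
    beta_reduce
    rw [if_neg (not_lt.2 (val_cast_castAdd_le (i := i) j)), add_zero]
  · -- right generator: `(q + s e₀) - s e₀ = q - 0 e₀`
    unfold rightGenV rightGenFnV
    congr 1
    funext j
    beta_reduce
    rw [if_pos (lt_val_cast_natAdd (i := i) j), timeVec_zero, sub_zero, add_sub_cancel_right]

end Slot

/-! ### Gram skeletons and norm bounds for the generators -/

section Gram

variable [NeZero d]

omit [NeZero d] in
/-- Appending two tensor clusters at vector positions. [folklore] -/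
theorem appendTensor_skeletonFnV_tensorFin {n m : ℕ} (ψ : Fin n → 𝓢(EuclideanSpace ℝ (Fin d), ℂ))
    (ψ' : Fin m → 𝓢(EuclideanSpace ℝ (Fin d), ℂ)) (q : Fin n → EuclideanSpace ℝ (Fin d))
    (q' : Fin m → EuclideanSpace ℝ (Fin d)) :
    (skeletonFnV (SchwartzMap.tensorFin n ψ) q).appendTensor (skeletonFnV (SchwartzMap.tensorFin m ψ') q') =
      skeletonFnV (SchwartzMap.tensorFin (n + m) (Fin.append ψ ψ')) (Fin.append q q') := by
  rw [skeletonFnV_tensorFin_add]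
  simp only [Fin.append_left, Fin.append_right]

/-- **The Gram function of a left generator is a cluster** of `2n` points. [folklore] -/
theorem osAdjoint_appendTensor_leftGenFnV {n m : ℕ} (ψ : Fin (n + m) → 𝓢(EuclideanSpace ℝ (Fin d), ℂ))
    (q : Fin (n + m) → EuclideanSpace ℝ (Fin d)) :
    (QuantumLattice.osAdjoint (leftGenFnV ψ q)).appendTensor (leftGenFnV ψ q) =
      skeletonFnV (SchwartzMap.tensorFin (n + n)
        (Fin.append (fun j => ψ (Fin.castAdd m j)) fun j => reflectOne (ψ (Fin.castAdd m (Fin.rev j)))))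
        (Fin.append (fun j => q (Fin.castAdd m j))
          fun j => QuantumLattice.timeReflection d (q (Fin.castAdd m (Fin.rev j)))) := by
  have h1 : QuantumLattice.osAdjoint (leftGenFnV ψ q) =
      skeletonFnV (SchwartzMap.tensorFin n fun j => ψ (Fin.castAdd m j)) fun j => q (Fin.castAdd m j) := by
    rw [leftGenFnV, QuantumLattice.osAdjoint_osAdjoint]
  rw [h1]
  conv_lhs => rw [leftGenFnV_eq]
  rw [appendTensor_skeletonFnV_tensorFin]

/-- **The Gram function of a right generator is a cluster** of `2m` points. [folklore] -/
theorem osAdjoint_appendTensor_rightGenFnV {n m : ℕ} (ψ : Fin (n + m) → 𝓢(EuclideanSpace ℝ (Fin d), ℂ))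
    (q : Fin (n + m) → EuclideanSpace ℝ (Fin d)) (t : ℝ) :
    (QuantumLattice.osAdjoint (rightGenFnV ψ q t)).appendTensor (rightGenFnV ψ q t) =
      skeletonFnV (SchwartzMap.tensorFin (m + m)
        (Fin.append (fun j => reflectOne (ψ (Fin.natAdd n (Fin.rev j)))) fun j => ψ (Fin.natAdd n j)))
        (Fin.append (fun j => QuantumLattice.timeReflection d (q (Fin.natAdd n (Fin.rev j)) - timeVec t))
          fun j => q (Fin.natAdd n j) - timeVec t) := by
  rw [rightGenFnV, osAdjoint_skeletonFnV_tensorFin, appendTensor_skeletonFnV_tensorFin]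

/-- **Norm bound of an OS vector through a Gram cluster at vector positions**:
`‖v(P)‖ ≤ C (1 + ‖A‖)ᴺ` when `ΘP* ⊗ P = skeletonFnV Ψ₀ A`. [folklore] -/
theorem exists_norm_δ_le_of_skeletonFnV (𝔖 : SchwingerFamily (EuclideanSpace ℝ (Fin d)))
    (hE2 : 𝔖.IsOSReflectionPositive) {n : ℕ} (Ψ₀ : 𝓢((Fin (n + n) → EuclideanSpace ℝ (Fin d)), ℂ)) :
    ∃ (C : ℝ) (N : ℕ), 0 ≤ C ∧ ∀ (P : 𝓢((Fin n → EuclideanSpace ℝ (Fin d)), ℂ)) (hP : IsPositiveTimeMulti P)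
      (A : Fin (n + n) → EuclideanSpace ℝ (Fin d)), (QuantumLattice.osAdjoint P).appendTensor P = skeletonFnV Ψ₀ A →
      ‖δ 𝔖 hE2 (mkGen P hP)‖ ≤ C * (1 + ‖A‖) ^ N := by
  obtain ⟨C, N, hC, hb⟩ := exists_norm_schwinger_skeletonFnV_le 𝔖 Ψ₀
  refine ⟨1 + C, N, by positivity, fun P hP A hA => ?_⟩
  have hsq : ‖δ 𝔖 hE2 (mkGen P hP)‖ ^ 2 ≤ C * (1 + ‖A‖) ^ N := by
    rw [norm_δ_sq]
    refine (RCLike.re_le_norm _).trans ?_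
    rw [genPairing_eq]
    change ‖𝔖 (n + n) ((QuantumLattice.osAdjoint P).appendTensor P)‖ ≤ _
    rw [hA]
    exact hb A
  have h1 : (1 : ℝ) ≤ (1 + ‖A‖) ^ N := one_le_pow₀ (by linarith [norm_nonneg A])
  nlinarith [norm_nonneg (δ 𝔖 hE2 (mkGen P hP)), hsq, mul_nonneg hC (zero_le_one.trans h1)]

variable {k : ℕ} (φ : Fin (k + 2) → 𝓢(EuclideanSpace ℝ (Fin d), ℂ))
  (ξ : Fin (k + 1) → EuclideanSpace ℝ (Fin d)) (ê : Fin d → EuclideanSpace ℝ (Fin d))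
  (i : Fin (k + 1)) (μ : Fin d) (g : ℝ)

omit [NeZero d] in
/-- `‖zeroSlot u‖ ≤ ‖u‖`. [folklore] -/
theorem norm_zeroSlot_le (u : Fin (k + 1) × Fin d → ℝ) : ‖zeroSlot i μ u‖ ≤ ‖u‖ := by
  refine (pi_norm_le_iff_of_nonneg (norm_nonneg _)).2 fun p => ?_
  unfold zeroSlot
  by_cases hp : p = (i, μ)
  · subst hp; simp
  · rw [Function.update_of_ne hp]; exact norm_le_pi_norm u p

/-- **Continuity of the anchored frame positions in `u`.** [folklore] -/
theorem continuous_framePos : Continuous fun u : Fin (k + 1) × Fin d → ℝ => framePos i μ ξ ê g u := by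
  have hz : Continuous (zeroSlot (k := k) (d := d) i μ) := by
    unfold zeroSlot
    exact continuous_pi fun p => by
      by_cases hp : p = (i, μ)
      · subst hp; simp only [Function.update_self]; exact continuous_const
      · simp only [Function.update_of_ne hp]; exact continuous_apply p
  have hp : Continuous fun u : Fin (k + 1) × Fin d → ℝ => posV ξ ê (zeroSlot i μ u) :=
    (continuous_posV ξ ê).comp hz
  unfold framePos
  refine continuous_pi fun j => ?_
  exact (((frameIso (ê μ)).continuous.comp ((continuous_apply j).comp hp)).sub
    ((frameIso (ê μ)).continuous.comp ((continuous_apply i.castSucc).comp hp))).sub continuous_const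

/-- **Affine bound of the anchored frame positions**:
`‖qⱼ(u)‖ ≤ 2 (k+1) (‖ξ‖ + (∑‖ê_μ‖) ‖u‖) + |g|/2`. [folklore] -/
theorem norm_framePos_le (u : Fin (k + 1) × Fin d → ℝ) (j : Fin (k + 2)) :
    ‖framePos i μ ξ ê g u j‖ ≤ 2 * ((k + 1) * (‖ξ‖ + (∑ ν, ‖ê ν‖) * ‖u‖)) + |g| / 2 := by
  unfold framePos
  have hE : 0 ≤ ∑ ν, ‖ê ν‖ := Finset.sum_nonneg fun ν _ => norm_nonneg _
  have hb : ∀ j', ‖frameIso (ê μ) (posV ξ ê (zeroSlot i μ u) j')‖ ≤ (k + 1) * (‖ξ‖ + (∑ ν, ‖ê ν‖) * ‖u‖) := by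
    intro j'
    rw [LinearIsometryEquiv.norm_map]
    refine (norm_le_pi_norm _ j').trans ((norm_posV_le ξ ê _).trans ?_)
    gcongr
    exact norm_zeroSlot_le i μ u
  have hg' : ‖(timeVec (g / 2) : EuclideanSpace ℝ (Fin d))‖ = |g| / 2 := by
    rw [timeVec, PiLp.norm_single, Real.norm_eq_abs, abs_div, abs_two]
  calc ‖frameIso (ê μ) (posV ξ ê (zeroSlot i μ u) j) - frameIso (ê μ) (posV ξ ê (zeroSlot i μ u) i.castSucc) -
        timeVec (g / 2)‖
      ≤ ‖frameIso (ê μ) (posV ξ ê (zeroSlot i μ u) j)‖ + ‖frameIso (ê μ) (posV ξ ê (zeroSlot i μ u) i.castSucc)‖ +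
        ‖(timeVec (g / 2) : EuclideanSpace ℝ (Fin d))‖ :=
        (norm_sub_le _ _).trans (add_le_add (norm_sub_le _ _) le_rfl)
    _ ≤ _ := by rw [hg']; linarith [hb j, hb i.castSucc]

/-- **Continuity of the left generator in `u`.** [folklore] -/
theorem continuous_leftGenV : Continuous fun u : Fin (k + 1) × Fin d → ℝ => leftGenV i μ φ ξ ê g u := by
  unfold leftGenV leftGenFnV
  refine QuantumLattice.continuous_osAdjoint.comp ((continuous_skeletonFnV _).comp ?_)
  exact continuous_pi fun j =>
    (continuous_apply (Fin.cast (nL_add_nR i) (Fin.castAdd (nR i) j))).comp (continuous_framePos ξ ê i μ g)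

/-- **Continuity of the right generator in `u`.** [folklore] -/
theorem continuous_rightGenV : Continuous fun u : Fin (k + 1) × Fin d → ℝ => rightGenV i μ φ ξ ê g u := by
  unfold rightGenV rightGenFnV
  refine (continuous_skeletonFnV _).comp ?_
  exact continuous_pi fun j =>
    ((continuous_apply (Fin.cast (nL_add_nR i) (Fin.natAdd (nL i) j))).comp
      (continuous_framePos ξ ê i μ g)).sub continuous_const

/-- **Polynomial norm bound for the vectors of the left generator.** [folklore] -/
theorem exists_norm_δ_leftGenV_le (𝔖 : SchwingerFamily (EuclideanSpace ℝ (Fin d))) (hE2 : 𝔖.IsOSReflectionPositive) :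
    ∃ (C : ℝ) (N : ℕ), 0 ≤ C ∧ ∀ (u : Fin (k + 1) × Fin d → ℝ) (hP : IsPositiveTimeMulti (leftGenV i μ φ ξ ê g u)),
      ‖δ 𝔖 hE2 (mkGen (leftGenV i μ φ ξ ê g u) hP)‖ ≤ C * (1 + ‖u‖) ^ N := by
  obtain ⟨C, N, hC, hb⟩ := exists_norm_δ_le_of_skeletonFnV 𝔖 hE2
    (SchwartzMap.tensorFin (nL i + nL i) (Fin.append (fun j => φrot i μ φ ê (Fin.castAdd (nR i) j))
      fun j => reflectOne (φrot i μ φ ê (Fin.castAdd (nR i) (Fin.rev j)))))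
  set B : ℝ := 2 * ((k + 1) * ‖ξ‖) + |g| / 2 + 1 with hB
  set B' : ℝ := 2 * ((k + 1) * ∑ ν, ‖ê ν‖) with hB'
  have hE : 0 ≤ ∑ ν, ‖ê ν‖ := Finset.sum_nonneg fun ν _ => norm_nonneg _
  refine ⟨C * (B + B') ^ N, N, by positivity, fun u hP => ?_⟩
  refine (hb _ hP _ (osAdjoint_appendTensor_leftGenFnV _ _)).trans ?_
  have hq : ∀ j, ‖framePos i μ ξ ê g u j‖ ≤ (B - 1) + B' * ‖u‖ := fun j => by
    refine (norm_framePos_le ξ ê i μ g u j).trans (le_of_eq ?_); rw [hB, hB']; ring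
  have hA : ‖Fin.append (fun j => framePos i μ ξ ê g u (Fin.cast (nL_add_nR i) (Fin.castAdd (nR i) j)))
      fun j => QuantumLattice.timeReflection d
        (framePos i μ ξ ê g u (Fin.cast (nL_add_nR i) (Fin.castAdd (nR i) (Fin.rev j))))‖ ≤ (B - 1) + B' * ‖u‖ := by
    refine (pi_norm_le_iff_of_nonneg ?_).2 fun J => ?_
    · have : 0 ≤ B' * ‖u‖ := by positivity
      rw [hB]; linarith [abs_nonneg g, (by positivity : (0 : ℝ) ≤ 2 * ((k + 1) * ‖ξ‖))]
    induction J using Fin.addCases with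
    | left j => rw [Fin.append_left]; exact hq _
    | right j => rw [Fin.append_right, LinearIsometryEquiv.norm_map]; exact hq _
  have hle : 1 + ((B - 1) + B' * ‖u‖) ≤ (B + B') * (1 + ‖u‖) := by
    have h1 : 1 ≤ B := by
      rw [hB]; linarith [abs_nonneg g, (by positivity : (0 : ℝ) ≤ 2 * ((k + 1) * ‖ξ‖))]
    nlinarith [norm_nonneg u, (by positivity : (0 : ℝ) ≤ B')]
  calc C * (1 + ‖Fin.append (fun j => framePos i μ ξ ê g u (Fin.cast (nL_add_nR i) (Fin.castAdd (nR i) j)))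
        fun j => QuantumLattice.timeReflection d
          (framePos i μ ξ ê g u (Fin.cast (nL_add_nR i) (Fin.castAdd (nR i) (Fin.rev j))))‖) ^ N
      ≤ C * ((B + B') * (1 + ‖u‖)) ^ N := by
        gcongr
        exact (add_le_add le_rfl hA).trans hle
    _ = C * (B + B') ^ N * (1 + ‖u‖) ^ N := by rw [mul_pow]; ring

/-- **Polynomial norm bound for the vectors of the right generator.** [folklore] -/
theorem exists_norm_δ_rightGenV_le (𝔖 : SchwingerFamily (EuclideanSpace ℝ (Fin d))) (hE2 : 𝔖.IsOSReflectionPositive) :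
    ∃ (C : ℝ) (N : ℕ), 0 ≤ C ∧ ∀ (u : Fin (k + 1) × Fin d → ℝ) (hP : IsPositiveTimeMulti (rightGenV i μ φ ξ ê g u)),
      ‖δ 𝔖 hE2 (mkGen (rightGenV i μ φ ξ ê g u) hP)‖ ≤ C * (1 + ‖u‖) ^ N := by
  obtain ⟨C, N, hC, hb⟩ := exists_norm_δ_le_of_skeletonFnV 𝔖 hE2
    (SchwartzMap.tensorFin (nR i + nR i) (Fin.append (fun j => reflectOne (φrot i μ φ ê (Fin.natAdd (nL i) (Fin.rev j))))
      fun j => φrot i μ φ ê (Fin.natAdd (nL i) j)))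
  set B : ℝ := 2 * ((k + 1) * ‖ξ‖) + |g| / 2 + 1 with hB
  set B' : ℝ := 2 * ((k + 1) * ∑ ν, ‖ê ν‖) with hB'
  have hE : 0 ≤ ∑ ν, ‖ê ν‖ := Finset.sum_nonneg fun ν _ => norm_nonneg _
  refine ⟨C * (B + B') ^ N, N, by positivity, fun u hP => ?_⟩
  refine (hb _ hP _ (osAdjoint_appendTensor_rightGenFnV _ _ 0)).trans ?_
  have hq : ∀ j, ‖framePos i μ ξ ê g u j - timeVec 0‖ ≤ (B - 1) + B' * ‖u‖ := fun j => by
    rw [timeVec_zero, sub_zero]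
    refine (norm_framePos_le ξ ê i μ g u j).trans (le_of_eq ?_); rw [hB, hB']; ring
  have hA : ‖Fin.append (fun j => QuantumLattice.timeReflection d
        (framePos i μ ξ ê g u (Fin.cast (nL_add_nR i) (Fin.natAdd (nL i) (Fin.rev j))) - timeVec 0))
      fun j => framePos i μ ξ ê g u (Fin.cast (nL_add_nR i) (Fin.natAdd (nL i) j)) - timeVec 0‖ ≤
      (B - 1) + B' * ‖u‖ := by
    refine (pi_norm_le_iff_of_nonneg ?_).2 fun J => ?_
    · have : 0 ≤ B' * ‖u‖ := by positivity
      rw [hB]; linarith [abs_nonneg g, (by positivity : (0 : ℝ) ≤ 2 * ((k + 1) * ‖ξ‖))]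
    induction J using Fin.addCases with
    | left j => rw [Fin.append_left, LinearIsometryEquiv.norm_map]; exact hq _
    | right j => rw [Fin.append_right]; exact hq _
  have hle : 1 + ((B - 1) + B' * ‖u‖) ≤ (B + B') * (1 + ‖u‖) := by
    have h1 : 1 ≤ B := by
      rw [hB]; linarith [abs_nonneg g, (by positivity : (0 : ℝ) ≤ 2 * ((k + 1) * ‖ξ‖))]
    nlinarith [norm_nonneg u, (by positivity : (0 : ℝ) ≤ B')]
  calc C * (1 + ‖Fin.append (fun j => QuantumLattice.timeReflection d
          (framePos i μ ξ ê g u (Fin.cast (nL_add_nR i) (Fin.natAdd (nL i) (Fin.rev j))) - timeVec 0))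
        fun j => framePos i μ ξ ê g u (Fin.cast (nL_add_nR i) (Fin.natAdd (nL i) j)) - timeVec 0‖) ^ N
      ≤ C * ((B + B') * (1 + ‖u‖)) ^ N := by
        gcongr
        exact (add_le_add le_rfl hA).trans hle
    _ = C * (B + B') ^ N * (1 + ‖u‖) ^ N := by rw [mul_pow]; ring

end Gram

/-! ### The holomorphic slot function -/

section SlotExt

variable [NeZero d] (𝔖 : SchwingerFamily (EuclideanSpace ℝ (Fin d))) (hE1 : 𝔖.IsEuclideanCovariant)
  (hE2 : 𝔖.IsOSReflectionPositive) {k : ℕ} (φ : Fin (k + 2) → 𝓢(EuclideanSpace ℝ (Fin d), ℂ))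
  (ξ : Fin (k + 1) → EuclideanSpace ℝ (Fin d)) (ê : Fin d → EuclideanSpace ℝ (Fin d))
  (i : Fin (k + 1)) (μ : Fin d) {g r : ℝ}
  (hφ : ∀ j, tsupport (φ j : EuclideanSpace ℝ (Fin d) → ℂ) ⊆ Metric.closedBall 0 r)
  (hê1 : ‖ê μ‖ = 1) (hêê : ∀ ν, 0 ≤ ⟪ê μ, ê ν⟫) (hξ : ∀ i', g ≤ ⟪ê μ, ξ i'⟫)
  (hg : 2 * r < g) (hr : 0 ≤ r)

/-- The componentwise absolute value of the parameters (so that the slot function is total). [folklore] -/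
def absParams (u : Fin (k + 1) × Fin d → ℝ) : Fin (k + 1) × Fin d → ℝ := fun p => |u p|

omit [NeZero d] in
/-- `absParams u ≥ 0`. [folklore] -/
theorem absParams_nonneg (u : Fin (k + 1) × Fin d → ℝ) (p : Fin (k + 1) × Fin d) : 0 ≤ absParams u p :=
  abs_nonneg _

omit [NeZero d] in
/-- `absParams u = u` for `u ≥ 0`. [folklore] -/
theorem absParams_of_nonneg {u : Fin (k + 1) × Fin d → ℝ} (hu : ∀ p, 0 ≤ u p) : absParams u = u :=
  funext fun p => abs_of_nonneg (hu p)

omit [NeZero d] in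
/-- `‖absParams u‖ = ‖u‖`. [folklore] -/
theorem norm_absParams (u : Fin (k + 1) × Fin d → ℝ) : ‖absParams u‖ = ‖u‖ := by
  simp only [Pi.norm_def, absParams, Real.nnnorm_abs]

omit [NeZero d] in
/-- `absParams` is continuous. [folklore] -/
theorem continuous_absParams : Continuous (absParams (k := k) (d := d)) :=
  continuous_pi fun p => (continuous_apply p).abs

/-- The **holomorphic slot function of the slot `(i, μ)`**:
`τ ↦ ⟪v(P_{iμ}(|u|)), e^{-τH} v(R_{iμ}(|u|))⟫`. [cite: OsterwalderSchraderCMP1975, Ch. V.1 eqs. (5.4), (5.7)] -/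
def slotExtV (u : Fin (k + 1) × Fin d → ℝ) (τ : ℂ) : ℂ :=
  gapContinuation 𝔖 hE1 hE2
    (mkGen (leftGenV i μ φ ξ ê g (absParams u))
      (isPositiveTimeMulti_leftGenV hφ hê1 hêê hξ hg hr (absParams_nonneg u)))
    (mkGen (rightGenV i μ φ ξ ê g (absParams u))
      (isPositiveTimeMulti_rightGenV hφ hê1 hêê hξ hg hr (absParams_nonneg u))) τ

/-- **On the real axis the slot function is the directional skeleton Schwinger function**:
`slotExtV u s = 𝒮(u[(i,μ) ↦ s])` for `u ≥ 0`, `s ≥ 0`. [cite: OsterwalderSchraderCMP1975, Ch. V.1 eq. (5.7)] -/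
theorem slotExtV_ofReal {u : Fin (k + 1) × Fin d → ℝ} (hu : ∀ p, 0 ≤ u p) {s : ℝ} (hs : 0 ≤ s) :
    slotExtV 𝔖 hE1 hE2 φ ξ ê i μ hφ hê1 hêê hξ hg hr u s = skelSV 𝔖 φ ξ ê (Function.update u (i, μ) s) := by
  rw [slotExtV, gapContinuation_ofReal _ _ hs, skelSV_update_eq_genPairing (g := g) hE1 hφ hê1 hêê hξ hg hr hu hs]
  exact genPairing_mkGen_congr 𝔖 (by rw [absParams_of_nonneg hu]) _ _ (by rw [absParams_of_nonneg hu]) _ _ s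

/-- **Holomorphy of the slot function** on `{Re τ > 0}`. [cite: OsterwalderSchraderCMP1975, Ch. V.1 p. 291] -/
theorem differentiableOn_slotExtV (u : Fin (k + 1) × Fin d → ℝ) :
    DifferentiableOn ℂ (slotExtV 𝔖 hE1 hE2 φ ξ ê i μ hφ hê1 hêê hξ hg hr u) {τ : ℂ | 0 < τ.re} :=
  differentiableOn_gapContinuation _ _

/-- **Continuity of the slot function** on `{Re τ ≥ 0}`. [folklore] -/
theorem continuousOn_slotExtV (u : Fin (k + 1) × Fin d → ℝ) :
    ContinuousOn (slotExtV 𝔖 hE1 hE2 φ ξ ê i μ hφ hê1 hêê hξ hg hr u) {τ : ℂ | 0 ≤ τ.re} :=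
  continuousOn_gapContinuation _ _

/-- **Polynomial bound of the slot function, uniformly on `{Re τ ≥ 0}`**:
`‖slotExtV u τ‖ ≤ C (1 + ‖u‖)ᴺ`. [cite: OsterwalderSchraderCMP1975, Ch. V.1 and Ch. VI.1] -/
theorem exists_norm_slotExtV_le :
    ∃ (C : ℝ) (N : ℕ), 0 ≤ C ∧ ∀ (u : Fin (k + 1) × Fin d → ℝ) (τ : ℂ), 0 ≤ τ.re →
      ‖slotExtV 𝔖 hE1 hE2 φ ξ ê i μ hφ hê1 hêê hξ hg hr u τ‖ ≤ C * (1 + ‖u‖) ^ N := by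
  obtain ⟨C₁, N₁, hC₁, h₁⟩ := exists_norm_δ_leftGenV_le φ ξ ê i μ g 𝔖 hE2
  obtain ⟨C₂, N₂, hC₂, h₂⟩ := exists_norm_δ_rightGenV_le φ ξ ê i μ g 𝔖 hE2
  refine ⟨C₁ * C₂, N₁ + N₂, by positivity, fun u τ hτ => ?_⟩
  refine (norm_gapContinuation_le _ _ hτ).trans ?_
  calc ‖δ 𝔖 hE2 (mkGen (leftGenV i μ φ ξ ê g (absParams u)) _)‖ *
        ‖δ 𝔖 hE2 (mkGen (rightGenV i μ φ ξ ê g (absParams u)) _)‖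
      ≤ (C₁ * (1 + ‖absParams u‖) ^ N₁) * (C₂ * (1 + ‖absParams u‖) ^ N₂) :=
        mul_le_mul (h₁ _ _) (h₂ _ _) (norm_nonneg _) (by positivity)
    _ = C₁ * C₂ * (1 + ‖u‖) ^ (N₁ + N₂) := by rw [norm_absParams, pow_add]; ring

/-- **Continuity of the slot function in `u`** at fixed `τ`. [folklore] -/
theorem continuous_slotExtV_left (τ : ℂ) :
    Continuous fun u : Fin (k + 1) × Fin d → ℝ => slotExtV 𝔖 hE1 hE2 φ ξ ê i μ hφ hê1 hêê hξ hg hr u τ := by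
  unfold slotExtV gapContinuation
  exact (continuous_ι_δ_mkGen hE2 ((continuous_leftGenV φ ξ ê i μ g).comp continuous_absParams) _).inner
    ((holoShiftH (hE2 := hE2) hE1 τ).continuous.comp
      (continuous_ι_δ_mkGen hE2 ((continuous_rightGenV φ ξ ê i μ g).comp continuous_absParams) _))

end SlotExt

end Literature.MathematicalPhysics.QuantumFieldTheory
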